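import Summits.CriticalPhenomena.PercolationContinuityZ3.Theorems.PercNearOneGluingNoHeavyLowerTailQ44TTConeUniversal

/-!
# Blob join: the terminal profile of a union of two configurations sharing only terminal vertices

Support file for crux `stmt-CriticalPhenomena-4575` (rows `W = 2·Q44`, `U`, `D_U`, `S3` for all `n`), seat `prim-bnk-1` gen 40;
memo `run/shared/lean/prim/prim-l12/FROM-prim-bnk-1-gen40-FIBRE-BRIDGE.md`.  This is step (i) of the LAW-LEVEL FIBRE BRIDGE
(gen-39 HANDOFF): the two-copy fibre of a weighted graph splits into BLOCKS (an internal component with its terminal edges, a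
terminal–terminal pair, …) which pairwise share only terminal vertices, and the terminal profile of a union of such blocks is the
JOIN of their profiles.

* `pp_pjoin_iff` — the join table `VCCone.pjoin` of the 15 cells IS the equivalence closure: `k ~ k'` in `pjoin i j` iff
  `Relation.EqvGen (joined in i ∨ joined in j) k k'`.
* `reachable_union_iff_eqvGen` — if every vertex common to an `ω`-pair and a `B`-pair is one of the marked points `q k`, then
  `q k₀ ↔ q k₁` in `ω ∪ B` iff `(k₀, k₁)` lies in the equivalence closure of (`ω`-reachability ∪ `B`-reachability) on the indices
  (an open walk alternates between `ω`-runs and `B`-runs and can switch only at marked points).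
* `prof_union_eq_pjoin` — hence `prof (ω ∪ B) = pp (pjoin i j)` when `prof ω = pp i`, `prof B = pp j`.
Generalises `VCCone.prof_union_star_eq_pp` (a star at a fresh vertex).  No sorries, no named facts, no new definitions;
standard axioms (`pjoin_spec` was checked by `decide` in `…Q44VertexCoverConeW`).
-/

namespace Summit.CriticalPhenomena.PercolationContinuityZ3.Theorems

namespace VCCone

open TwoCopyMono FourPointAtoms Literature.Probability.Percolation

variable {n : ℕ}

/-! ## The join table is the equivalence closure -/

/-- `pjoin i j` joins `k, k'` iff they are joined in the smallest equivalence containing the blocks of `i` and of `j`. [this work] -/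
theorem pp_pjoin_iff (i j : Fin 15) (k k' : Fin 4) :
    pp (pjoin i j) k k' = true ↔ Relation.EqvGen (fun u v => pp i u v = true ∨ pp j u v = true) k k' := by
  classical
  constructor
  · intro h
    -- the closure is an equivalence profile, hence one of the 15 cells `m`, which lies above `i` and `j`
    set E : Prof := fun u v => decide (Relation.EqvGen (fun u v => pp i u v = true ∨ pp j u v = true) u v) with hE
    have hEqv : IsEqv E := by
      refine ⟨fun u => ?_, fun u v huv => ?_, fun u v x huv hvx => ?_⟩
      · exact decide_eq_true (Relation.EqvGen.refl u)
      · exact decide_eq_true (Relation.EqvGen.symm _ _ (of_decide_eq_true huv))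
      · exact decide_eq_true (Relation.EqvGen.trans _ _ _ (of_decide_eq_true huv) (of_decide_eq_true hvx))
    obtain ⟨m, hm⟩ := exists_pat_of_isEqv hEqv
    have h1 : ple i m = true := by
      refine ple_of_profLE ⟨fun u v huv => ?_⟩
      rw [← hm]; exact decide_eq_true (Relation.EqvGen.rel u v (Or.inl huv))
    have h2 : ple j m = true := by
      refine ple_of_profLE ⟨fun u v huv => ?_⟩
      rw [← hm]; exact decide_eq_true (Relation.EqvGen.rel u v (Or.inr huv))
    have h3 : ple (pjoin i j) m = true := (pjoin_spec i j).2.2 m h1 h2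
    have h4 : pp m k k' = true := (profLE_of_ple h3).le k k' h
    rw [← hm] at h4
    exact of_decide_eq_true h4
  · intro h
    induction h with
    | rel u v huv =>
      rcases huv with huv | huv
      · exact (profLE_of_ple (pjoin_spec i j).1).le u v huv
      · exact (profLE_of_ple (pjoin_spec i j).2.1).le u v huv
    | refl u => exact (isEqv_pp _).refl u
    | symm u v _ ih => exact (isEqv_pp _).symm u v ih
    | trans u v x _ _ ih1 ih2 => exact (isEqv_pp _).trans u v x ih1 ih2

/-! ## Reachability in a union of two configurations sharing only marked vertices -/

/-- A nontrivial open path ends with an open pair containing its end point. [folklore] -/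
theorem exists_mem_of_reachable_ne (B : Set (Sym2 (Fin n))) {x u : Fin n} (h : (openGraph B).Reachable x u) (hne : x ≠ u) :
    ∃ e ∈ B, u ∈ e := by
  rw [SimpleGraph.reachable_iff_reflTransGen] at h
  rcases Relation.ReflTransGen.cases_tail h with heq | ⟨m, _, hadj⟩
  · exact absurd heq.symm hne
  · rw [openGraph_adj] at hadj
    exact ⟨s(m, u), hadj.1, Sym2.mem_iff.2 (Or.inr rfl)⟩

/-- **Blob join (reachability form).**  If every vertex lying on both an `ω`-pair and a `B`-pair is a marked point `q k`, then two
marked points are joined in `ω ∪ B` iff their indices are joined in the equivalence closure of `ω`-reachability and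
`B`-reachability of marked points. [this work] -/
theorem reachable_union_iff_eqvGen (ω B : Set (Sym2 (Fin n))) (q : Fin 4 → Fin n)
    (hsep : ∀ e ∈ ω, ∀ e' ∈ B, ∀ v : Fin n, v ∈ e → v ∈ e' → ∃ k, q k = v) (k₀ k₁ : Fin 4) :
    (openGraph (ω ∪ B)).Reachable (q k₀) (q k₁) ↔
      Relation.EqvGen (fun k k' => (openGraph ω).Reachable (q k) (q k') ∨ (openGraph B).Reachable (q k) (q k')) k₀ k₁ := by
  set R : Fin 4 → Fin 4 → Prop := fun k k' => (openGraph ω).Reachable (q k) (q k') ∨ (openGraph B).Reachable (q k) (q k')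
    with hR
  constructor
  · intro h
    rw [SimpleGraph.reachable_iff_reflTransGen] at h
    -- invariant along an open walk from `q k₀`
    suffices H : ∀ v, Relation.ReflTransGen (openGraph (ω ∪ B)).Adj (q k₀) v →
        ∃ k, Relation.EqvGen R k₀ k ∧ ((openGraph ω).Reachable (q k) v ∨ (openGraph B).Reachable (q k) v) by
      obtain ⟨k, hk, hr⟩ := H _ h
      exact hk.trans _ _ _ (Relation.EqvGen.rel _ _ hr)
    intro v hv
    induction hv with
    | refl => exact ⟨k₀, Relation.EqvGen.refl _, Or.inl (SimpleGraph.Reachable.refl _)⟩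
    | @tail u v _ huv ih =>
      obtain ⟨k, hk, hr⟩ := ih
      rw [openGraph_adj] at huv
      obtain ⟨hmem, hne⟩ := huv
      rcases (Set.mem_union _ _ _).1 hmem with hω | hB
      · have hadj : (openGraph ω).Adj u v := (openGraph_adj _ _ _).2 ⟨hω, hne⟩
        rcases hr with hr | hr
        · exact ⟨k, hk, Or.inl (hr.trans hadj.reachable)⟩
        · by_cases hu : q k = u
          · refine ⟨k, hk, Or.inl ?_⟩
            rw [hu]; exact hadj.reachable
          · -- the walk switches from `B` to `ω` at `u`, so `u` is a marked point
            obtain ⟨e', he', hue'⟩ := exists_mem_of_reachable_ne B hr hu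
            obtain ⟨k', hk'⟩ := hsep _ hω e' he' u (Sym2.mem_iff.2 (Or.inl rfl)) hue'
            refine ⟨k', hk.trans _ _ _ (Relation.EqvGen.rel _ _ (Or.inr ?_)), Or.inl ?_⟩
            · rw [hk']; exact hr
            · rw [hk']; exact hadj.reachable
      · have hadj : (openGraph B).Adj u v := (openGraph_adj _ _ _).2 ⟨hB, hne⟩
        rcases hr with hr | hr
        · by_cases hu : q k = u
          · refine ⟨k, hk, Or.inr ?_⟩
            rw [hu]; exact hadj.reachable
          · obtain ⟨e', he', hue'⟩ := exists_mem_of_reachable_ne ω hr hu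
            obtain ⟨k', hk'⟩ := hsep e' he' _ hB u hue' (Sym2.mem_iff.2 (Or.inl rfl))
            refine ⟨k', hk.trans _ _ _ (Relation.EqvGen.rel _ _ (Or.inl ?_)), Or.inr ?_⟩
            · rw [hk']; exact hr
            · rw [hk']; exact hadj.reachable
        · exact ⟨k, hk, Or.inr (hr.trans hadj.reachable)⟩
  · intro h
    have hω : ∀ {x z : Fin n}, (openGraph ω).Reachable x z → (openGraph (ω ∪ B)).Reachable x z :=
      fun h => h.mono (openGraph_mono Set.subset_union_left)
    have hB : ∀ {x z : Fin n}, (openGraph B).Reachable x z → (openGraph (ω ∪ B)).Reachable x z :=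
      fun h => h.mono (openGraph_mono Set.subset_union_right)
    induction h with
    | rel u v huv =>
      rcases huv with huv | huv
      · exact hω huv
      · exact hB huv
    | refl u => exact SimpleGraph.Reachable.refl _
    | symm u v _ ih => exact ih.symm
    | trans u v x _ _ ih1 ih2 => exact ih1.trans ih2

/-- **Blob join (profile form).**  Under the same separation hypothesis for the marked points `a b c y`: if `prof ω = pp i` and
`prof B = pp j` then `prof (ω ∪ B) = pp (pjoin i j)`. [this work] -/
theorem prof_union_eq_pjoin (a b c y : Fin n) (ω B : Set (Sym2 (Fin n)))
    (hsep : ∀ e ∈ ω, ∀ e' ∈ B, ∀ v : Fin n, v ∈ e → v ∈ e' → ∃ k, quad a b c y k = v)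
    {i j : Fin 15} (hi : prof a b c y ω = pp i) (hj : prof a b c y B = pp j) :
    prof a b c y (ω ∪ B) = pp (pjoin i j) := by
  funext k k'
  apply Bool.eq_iff_iff.2
  rw [prof_true_iff, reachable_union_iff_eqvGen ω B (quad a b c y) hsep, pp_pjoin_iff]
  have e1 : (fun u v => (openGraph ω).Reachable (quad a b c y u) (quad a b c y v) ∨
      (openGraph B).Reachable (quad a b c y u) (quad a b c y v)) = fun u v => pp i u v = true ∨ pp j u v = true := by
    funext u v
    rw [← prof_true_iff, ← prof_true_iff, hi, hj]
  rw [e1]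

end VCCone

end Summit.CriticalPhenomena.PercolationContinuityZ3.Theorems
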